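import Literature.MathematicalPhysics.QuantumFieldTheory.Balaban1983to89.BlockAveragingEMLLinearised
import Literature.MathematicalPhysics.QuantumFieldTheory.Balaban1983to89.B5Eq112RenormTransf
import Literature.MathematicalPhysics.QuantumFieldTheory.Balaban1983to89.TorusGeometry
import HarnessLib

/-!
# Route `UnitScaleTilt`, crux K1 child «MinimiserStabilityRegPr» (stmt-QuantumFields-19200), registered stub `stub_prop7From14` (skeleton birth_v5
# 98cb23610ad7; leaf V3 «Prop 7 from a background (14)») — sub-lemma V3-C, one step at the flat background: **THE LINEARISED (0.4)-AVERAGE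
# `Q₁ = L·Q − dλ̄` (`BlockAveragingEMLLinearised.linAvg`) IS ONTO, WITH AN EXPLICIT RIGHT INVERSE** — far-face lift of the main term plus a
# coarse-gauge correction cancelling the comb term

Cell `ym3-torus` ∕ fleet seat `ym-ust-19200-p1` (gen 3).  WHY.  [Balaban1985Variational] Sect. C builds the chart (47) `A = A′ − HD(A′)` on a right
inverse `H` of the LINEARISED averaging ((45) «L^jηQ_jHB = B»).  For the T³ family's (0.4)-averaging of record the one-step linearisation at `U = 1`
is `Q₁Y = L·(bondAvg Y) − (λ̄_Y(y′) − λ̄_Y(y))` (seat ym-ust-19200-p2: `BlockAveragingEMLLinearised.linAvg_eq_bondAvg_sub_grad_combMean`, p482040/p483315,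
`λ̄_Y` = `combMean Y` the block mean of the comb potential), NOT the straight-line main term alone, and `Q₁(dλ) = λ(emb y′) − λ(emb y)` (`linAvg_grad`).
Hence a right inverse of the TRUE linearisation is: any right inverse of the main term (`B5Eq112RenormTransf.faceField`, or the `k`-uniform tent
right inverse of this seat's `…LineAvgRightInverse`) followed by the coarse-gauge correction `Y ↦ Y + d(λ̄_Y ∘ blockOf)` — recorded here in the
simplest (far-face) form.

WHAT IS PROVED (sorry-free, no definition; nothing of the papers asserted).
* `walkSum_add'`, `linAvg_add` — additivity of the signed walk sums and of `Q₁` in the bond field.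
* **`linAvg_rightInverse`**: for every coarse `Z` (values in `Matrix n n ℂ`) and `j + 1 ≤ m + K`, with `X = faceField(L⁻¹Z)` and `λ = combMean X ∘ blockOf`:
  `Q₁(X + dλ) = Z` (`bondAvg_faceField`, `blockOf_emb`, and the two identities above); **`linAvg_surjective`**.

HONEST SCOPE.  One step, flat background, the explicit (not the minimal-norm) right inverse, no bounds stated (sup bound `(1 + 2(d+2)L)·max‖Z‖` is
immediate from the lengths of the staircases but not recorded); the `k`-fold composition ([Balaban1985Averaging] Prop. 4) and the background
version (`covLinAvgR0`, p484812) are not touched.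

References: T. Bałaban, CMP 102 (1985) 277–309 [Balaban1985Variational] ((45)–(47) p.285); CMP 98 (1985) 17–51 [Balaban1985Averaging] ((62) p.28,
(124)–(125) p.36); CMP 95 (1984) 17–40 [Balaban1984PropagatorsI] ((1.8)–(1.11) p.19).
-/

noncomputable section

open scoped BigOperators

namespace Summit.QuantumFields.YangMills.Theorems.Prop7LinAvgOnto

open Literature.MathematicalPhysics.QuantumFieldTheory.Balaban1983to89
open LatticeFieldCalculus BlockAveragingEMLLinearised B5Eq112RenormTransf

variable {P : Params} {j : ℕ} {n : Type*}

/-- The signed sum along a walk is additive in the bond field. [cite: Balaban1984PropagatorsI, (1.8) p.19] -/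
theorem walkSum_add' {V : Type*} [AddCommGroup V] (Y Y' : PBond P j → V) (γ : List (T4Continuum.LStep P j)) :
    walkSum (fun b => Y b + Y' b) γ = walkSum Y γ + walkSum Y' γ := by
  induction γ with
  | nil => simp
  | cons s γ ih =>
    rw [walkSum_cons, walkSum_cons, walkSum_cons, ih]
    split_ifs <;> abel

/-- The linearised one-step average is additive in the bond field. [cite: Balaban1985Averaging, (124)-(125) p.36] -/
theorem linAvg_add (Y Y' : PBond P j → Matrix n n ℂ) (c : PBond P (j + 1)) :
    linAvg (fun b => Y b + Y' b) c = linAvg Y c + linAvg Y' c := by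
  rw [linAvg_def, linAvg_def, linAvg_def, ← smul_add, ← Finset.sum_add_distrib]
  congr 1
  refine Finset.sum_congr rfl fun i _ => ?_
  rw [walkSum_add', walkSum_add', walkSum_add']
  abel

/-- **THE LINEARISED ONE-STEP (0.4)-AVERAGE AT THE FLAT BACKGROUND IS ONTO, WITH AN EXPLICIT RIGHT INVERSE**: for every coarse bond field
`Z`, the fine field `Y = X + dλ` with `X` the far-face lift of `L⁻¹Z` (`B5Eq112RenormTransf.faceField`, `Q(X) = L⁻¹Z` for the straight-line
average `Q = bondAvg` of record) and `λ = (block-mean comb potential of X) ∘ blockOf` (so that the coarse gradient `dλ` cancels the comb term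
`−(λ̄_X(y′) − λ̄_X(y))` of `Q₁ = L·Q − d λ̄` — `linAvg_eq_bondAvg_sub_grad_combMean` — through the covariance `Q₁(dλ) = λ(emb y′) − λ(emb y)`,
`linAvg_grad`) satisfies `Q₁Y = Z` ([Balaban1985Variational] (45): a right inverse `H` of the linearised averaging exists; here for one step at
`U₀ = 1`). [cite: Balaban1985Variational, (45) p.285; Balaban1985Averaging, (124)-(125) p.36] -/
theorem linAvg_rightInverse (hj : j + 1 ≤ P.m + P.K) (Z : PBond P (j + 1) → Matrix n n ℂ) (c : PBond P (j + 1)) :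
    linAvg (fun b : PBond P j =>
        faceField (fun c' => ((P.L : ℝ)⁻¹) • Z c') b
          + ((fun x : Site P j => combMean (faceField (fun c' => ((P.L : ℝ)⁻¹) • Z c')) (blockOf x)) b.tgt
            - (fun x : Site P j => combMean (faceField (fun c' => ((P.L : ℝ)⁻¹) • Z c')) (blockOf x)) b.src)) c
      = Z c := by
  set X : PBond P j → Matrix n n ℂ := faceField (fun c' => ((P.L : ℝ)⁻¹) • Z c') with hX
  set lam : Site P j → Matrix n n ℂ := fun x => combMean X (blockOf x) with hlam
  rw [linAvg_add X (fun b => lam b.tgt - lam b.src) c, linAvg_eq_bondAvg_sub_grad_combMean, linAvg_grad]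
  have hQ : bondAvg X c = ((P.L : ℝ)⁻¹) • Z c := by
    rw [hX, bondAvg_faceField hj]
  have h1 : lam (emb c.tgt) = combMean X c.tgt := by
    simp only [hlam, Site.blockOf_emb hj]
  have h2 : lam (emb c.src) = combMean X c.src := by
    simp only [hlam, Site.blockOf_emb hj]
  rw [hQ, h1, h2]
  have hL : (P.L : ℝ) ≠ 0 := Nat.cast_ne_zero.mpr P.L_pos.ne'
  have hsmul : ((P.L : ℕ) : ℂ) • (((P.L : ℝ)⁻¹) • Z c) = Z c := by
    rw [show ((P.L : ℕ) : ℂ) = ((P.L : ℝ) : ℂ) by push_cast; rfl, ← Complex.coe_smul, smul_smul]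
    rw [show ((P.L : ℝ) : ℂ) * (((P.L : ℝ)⁻¹ : ℝ) : ℂ) = 1 by rw [← Complex.ofReal_mul, mul_inv_cancel₀ hL]; simp, one_smul]
  rw [hsmul]
  abel

/-- Hence `Q₁` is surjective. [cite: Balaban1985Variational, (45) p.285] -/
theorem linAvg_surjective (hj : j + 1 ≤ P.m + P.K) :
    Function.Surjective (fun Y : PBond P j → Matrix n n ℂ => fun c : PBond P (j + 1) => linAvg Y c) :=
  fun Z => ⟨_, funext fun c => linAvg_rightInverse hj Z c⟩

end Summit.QuantumFields.YangMills.Theorems.Prop7LinAvgOnto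

end
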